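import Mathlib.MeasureTheory.Group.GeometryOfNumbers
import Mathlib.Algebra.Module.ZLattice.Basic
import Mathlib.MeasureTheory.Measure.Lebesgue.VolumeOfBalls
import Mathlib.LinearAlgebra.Matrix.Determinant.Basic
import Mathlib.Analysis.SpecialFunctions.Pow.Real
import HarnessLib

/-!
# Welsh 2018 / Hooley 1978: generators of the ideals `(m, 2^{1/3} - ν)` of `ℤ[2^{1/3}]`
# (elementary replacement for "class number one")

Support file for `Literature/NumberTheory/Sieve/WelshCubicRoots.lean` (Theorem 1 of
M. C. Welsh, *Spacing and a large sieve type inequality for roots of a cubic congruence*,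
arXiv:1809.05211). Welsh (§3, p. 7) writes the primitive ideal `I` of `𝒪 = ℤ[2^{1/3}]` attached by
his Lemma 1 to a root `ν` of `X³ ≡ 2 (mod m)` — the lattice with `ℤ`-basis `m, 2^{1/3} - ν,
2^{2/3} - ν²`, i.e. `I_ν = {x + y2^{1/3} + z2^{2/3} : m ∣ x + yν + zν²}` — as `I = (α)`,
`α = a + b2^{1/3} + c2^{2/3}`, "using crucially that `ℤ[2^{1/3}]` has class number one".

This file proves exactly the consequence that is needed, in elementary terms (triples of integers,
norm form `N(x,y,z) = x³ + 2y³ + 4z³ - 6xyz`): for `m ≥ 1` and `m ∣ ν³ - 2` there are integers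
`a, b, c` with `m ∣ a + bν + cν²` and `N(a,b,c) = m` (`exists_generator`). Route:
* Minkowski's convex body theorem (Mathlib) for the lattice `I_ν ⊂ ℝ³` (covolume `m`) and the
  convex body `|ℓ₁| + |ℓ₂| + √3|ℓ₃| < 4·2^{1/3}·m^{1/3}`, where for `θ = 2^{1/3}`,
  `ℓ₁ = x + θy + θ²z` (real embedding) and `ℓ₂ = 2x - θy - θ²z`, `√3ℓ₃ = √3(θy - θ²z)` (twice the
  real and imaginary parts of the complex embedding), of volume `128m/(9√3) > 8m`;
* the factorisation `4N = ℓ₁(ℓ₂² + 3ℓ₃²)` and AM–GM give a non-zero lattice point with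
  `|N| < 128m/27 < 5m`, while `m ∣ N` on `I_ν` and `N ≠ 0` off the origin (2-adic descent);
* norms `2m', 3m, 4m` are reduced to `m` by dividing by `θ` (norm 2) resp. `1 + θ` (norm 3), which
  stays inside `I_ν` because `gcd(m, ν) ∣ 2`, `4 ∤ m`, resp. `gcd(m, 1+ν) ∣ 3`, `9 ∤ m`.
Statements are over an arbitrary real `θ` with `θ³ = 2` (instantiated with `2^{1/3}` by the user).

## References
* [Welsh2018CubicCongruenceSpacing] M. C. Welsh, arXiv:1809.05211 (2018), Lemma 1 (p. 6), §3 (p. 7).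
* [Hooley1978CubicPrimeFactor] C. Hooley, J. reine angew. Math. 303/304 (1978) 21–50.
-/

noncomputable section

namespace Literature.NumberTheory.Sieve

namespace Welsh2018

open MeasureTheory Module Submodule

/-- The factorisation of the norm form of `ℤ[2^{1/3}]` over `ℝ`: for `θ³ = 2`,
`4(x³ + 2y³ + 4z³ - 6xyz) = (x + θy + θ²z)·((2x - θy - θ²z)² + 3(θy - θ²z)²)`
(real embedding times the squared modulus of the complex embedding). [folklore] -/
theorem four_mul_normForm_eq {θ : ℝ} (hθ : θ ^ 3 = 2) (x y z : ℝ) :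
    4 * (x ^ 3 + 2 * y ^ 3 + 4 * z ^ 3 - 6 * x * y * z) =
      (x + θ * y + θ ^ 2 * z) * ((2 * x - θ * y - θ ^ 2 * z) ^ 2 + 3 * (θ * y - θ ^ 2 * z) ^ 2) := by
  linear_combination (-(4 * y ^ 3 + 4 * (θ ^ 3 + 2) * z ^ 3 - 12 * x * y * z)) * hθ

/-- AM–GM in the form used here: for `0 ≤ P` and any `Q`, `P·Q² ≤ ((P + 2|Q|)/3)³`. [folklore] -/
theorem mul_sq_le_cube_div (P Q : ℝ) (hP : 0 ≤ P) :
    P * Q ^ 2 ≤ ((P + 2 * |Q|) / 3) ^ 3 := by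
  have hQ : 0 ≤ |Q| := abs_nonneg Q
  have h1 : ((P + 2 * |Q|) / 3) ^ 3 - P * |Q| ^ 2 = (P - |Q|) ^ 2 * (P + 8 * |Q|) / 27 := by ring
  have h2 : 0 ≤ (P - |Q|) ^ 2 * (P + 8 * |Q|) / 27 := by positivity
  have h3 : P * Q ^ 2 = P * |Q| ^ 2 := by rw [sq_abs]
  linarith

/-- The norm form is bounded by the cube of one third of `|ℓ₁| + |ℓ₂| + √3|ℓ₃|`:
`|x³ + 2y³ + 4z³ - 6xyz| ≤ ((|x + θy + θ²z| + |2x - θy - θ²z| + √3|θy - θ²z|)/3)³`. [folklore] -/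
theorem abs_normForm_le {θ : ℝ} (hθ : θ ^ 3 = 2) (x y z : ℝ) :
    |x ^ 3 + 2 * y ^ 3 + 4 * z ^ 3 - 6 * x * y * z| ≤
      ((|x + θ * y + θ ^ 2 * z| + |2 * x - θ * y - θ ^ 2 * z| + Real.sqrt 3 * |θ * y - θ ^ 2 * z|)
        / 3) ^ 3 := by
  set l₁ := x + θ * y + θ ^ 2 * z with hl₁
  set l₂ := 2 * x - θ * y - θ ^ 2 * z with hl₂
  set l₃ := θ * y - θ ^ 2 * z with hl₃
  have hs3 : Real.sqrt 3 ^ 2 = 3 := Real.sq_sqrt (by norm_num)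
  have hs0 : 0 ≤ Real.sqrt 3 := Real.sqrt_nonneg 3
  have hid := four_mul_normForm_eq hθ x y z
  -- |4N| = |l₁| (l₂² + 3 l₃²) ≤ |l₁| (|l₂| + √3 |l₃|)²
  have hW : 0 ≤ l₂ ^ 2 + 3 * l₃ ^ 2 := by positivity
  have hW' : l₂ ^ 2 + 3 * l₃ ^ 2 ≤ (|l₂| + Real.sqrt 3 * |l₃|) ^ 2 := by
    have e : (|l₂| + Real.sqrt 3 * |l₃|) ^ 2 =
        l₂ ^ 2 + 3 * l₃ ^ 2 + 2 * (Real.sqrt 3 * (|l₂| * |l₃|)) := by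
      have := sq_abs l₂; have := sq_abs l₃
      nlinarith [hs3]
    rw [e]
    have : 0 ≤ Real.sqrt 3 * (|l₂| * |l₃|) := by positivity
    linarith
  have habs : |x ^ 3 + 2 * y ^ 3 + 4 * z ^ 3 - 6 * x * y * z| = |l₁| * (l₂ ^ 2 + 3 * l₃ ^ 2) / 4 := by
    have : x ^ 3 + 2 * y ^ 3 + 4 * z ^ 3 - 6 * x * y * z = l₁ * (l₂ ^ 2 + 3 * l₃ ^ 2) / 4 := by
      linarith
    rw [this, abs_div, abs_mul, abs_of_nonneg hW]
    norm_num
  rw [habs]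
  have hmain := mul_sq_le_cube_div |l₁| ((|l₂| + Real.sqrt 3 * |l₃|) / 2) (abs_nonneg _)
  have hpos : 0 ≤ |l₂| + Real.sqrt 3 * |l₃| := by positivity
  rw [abs_of_nonneg (by positivity : 0 ≤ (|l₂| + Real.sqrt 3 * |l₃|) / 2)] at hmain
  calc |l₁| * (l₂ ^ 2 + 3 * l₃ ^ 2) / 4 ≤ |l₁| * (|l₂| + Real.sqrt 3 * |l₃|) ^ 2 / 4 := by
        gcongr
    _ = |l₁| * ((|l₂| + Real.sqrt 3 * |l₃|) / 2) ^ 2 := by ring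
    _ ≤ ((|l₁| + 2 * ((|l₂| + Real.sqrt 3 * |l₃|) / 2)) / 3) ^ 3 := hmain
    _ = ((|l₁| + |l₂| + Real.sqrt 3 * |l₃|) / 3) ^ 3 := by ring

/-- **Minkowski step.** For `m ≥ 1` and any integer `ν`, the lattice
`I_ν = {(x,y,z) ∈ ℤ³ : m ∣ x + yν + zν²}` (covolume `m`) has a non-zero point in the convex body
`|x + θy + θ²z| + |2x - θy - θ²z| + √3|θy - θ²z| < 4θμ` (`θ³ = 2`, `μ³ = m`), whose volume is
`128m/(9√3) > 2³m`. [folklore] (Minkowski's convex body theorem, via Mathlib.) -/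
theorem exists_ne_zero_mem_lattice {θ μ : ℝ} (hθ : θ ^ 3 = 2) (hθ0 : 0 < θ) (m : ℕ) (hm : 1 ≤ m)
    (hμ : μ ^ 3 = m) (hμ0 : 0 < μ) (ν : ℤ) :
    ∃ p q r : ℤ, (p ≠ 0 ∨ q ≠ 0 ∨ r ≠ 0) ∧ (m : ℤ) ∣ p + q * ν + r * ν ^ 2 ∧
      |(p : ℝ) + θ * q + θ ^ 2 * r| + |2 * (p : ℝ) - θ * q - θ ^ 2 * r|
        + Real.sqrt 3 * |θ * q - θ ^ 2 * r| < 4 * θ * μ := by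
  classical
  have hm0 : (m : ℝ) ≠ 0 := by exact_mod_cast (show m ≠ 0 by omega)
  -- the lattice basis `m, θ - ν, θ² - ν²` in coordinates
  let bv : Fin 3 → (Fin 3 → ℝ) := ![![(m : ℝ), 0, 0], ![-(ν : ℝ), 1, 0], ![-(ν : ℝ) ^ 2, 0, 1]]
  have hdet : (Matrix.of bv).det = m := by
    simp [Matrix.det_fin_three, bv]
  have hli : LinearIndependent ℝ bv := by
    have h := Matrix.linearIndependent_rows_of_det_ne_zero (A := Matrix.of bv) (by rw [hdet]; exact hm0)
    exact h
  let b : Basis (Fin 3) ℝ (Fin 3 → ℝ) := basisOfPiSpaceOfLinearIndependent hli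
  have hb : ⇑b = bv := coe_basisOfPiSpaceOfLinearIndependent hli
  have h_fund := ZSpan.isAddFundamentalDomain' b volume
  have hcount : Countable (span ℤ (Set.range b)).toAddSubgroup := by
    change Countable (span ℤ (Set.range b)); infer_instance
  -- the convex body
  let T : Matrix (Fin 3) (Fin 3) ℝ :=
    !![1, θ, θ ^ 2; 2, -θ, -θ ^ 2; 0, Real.sqrt 3 * θ, -(Real.sqrt 3 * θ ^ 2)]
  let O : Set (Fin 3 → ℝ) := {x | (∑ i, |x i| ^ (1 : ℝ)) ^ (1 / (1 : ℝ)) < 4 * θ * μ}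
  let S : Set (Fin 3 → ℝ) := (Matrix.toLin' T) ⁻¹' O
  have hO : ∀ x : Fin 3 → ℝ, x ∈ O ↔ |x 0| + |x 1| + |x 2| < 4 * θ * μ := by
    intro x
    simp only [O, Set.mem_setOf_eq, Real.rpow_one, div_one, Fin.sum_univ_three]
  have hT : ∀ x : Fin 3 → ℝ, Matrix.toLin' T x =
      ![x 0 + θ * x 1 + θ ^ 2 * x 2, 2 * x 0 - θ * x 1 - θ ^ 2 * x 2,
        Real.sqrt 3 * θ * x 1 - Real.sqrt 3 * θ ^ 2 * x 2] := by
    intro x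
    ext i
    fin_cases i <;>
      simp [T, Matrix.toLin'_apply, Matrix.mulVec, dotProduct, Fin.sum_univ_three] <;> ring
  have hS : ∀ x : Fin 3 → ℝ, x ∈ S ↔ |x 0 + θ * x 1 + θ ^ 2 * x 2|
      + |2 * x 0 - θ * x 1 - θ ^ 2 * x 2|
      + |Real.sqrt 3 * θ * x 1 - Real.sqrt 3 * θ ^ 2 * x 2| < 4 * θ * μ := by
    intro x
    simp only [S, Set.mem_preimage, hT, hO]
    simp
  have h_symm : ∀ x ∈ S, -x ∈ S := by
    intro x hx
    rw [hS] at hx ⊢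
    simp only [Pi.neg_apply]
    have e1 : |-x 0 + θ * -x 1 + θ ^ 2 * -x 2| = |x 0 + θ * x 1 + θ ^ 2 * x 2| := by
      rw [← abs_neg]; ring_nf
    have e2 : |2 * -x 0 - θ * -x 1 - θ ^ 2 * -x 2| = |2 * x 0 - θ * x 1 - θ ^ 2 * x 2| := by
      rw [← abs_neg]; ring_nf
    have e3 : |Real.sqrt 3 * θ * -x 1 - Real.sqrt 3 * θ ^ 2 * -x 2|
        = |Real.sqrt 3 * θ * x 1 - Real.sqrt 3 * θ ^ 2 * x 2| := by
      rw [← abs_neg]; ring_nf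
    rw [e1, e2, e3]; exact hx
  have h_conv : Convex ℝ S := by
    have hOc : Convex ℝ O := by
      intro x hx y hy a c ha hc hac
      rw [hO] at hx hy ⊢
      simp only [Pi.add_apply, Pi.smul_apply, smul_eq_mul]
      have t0 : ∀ i, |a * x i + c * y i| ≤ a * |x i| + c * |y i| := by
        intro i
        calc |a * x i + c * y i| ≤ |a * x i| + |c * y i| := abs_add_le _ _
          _ = a * |x i| + c * |y i| := by rw [abs_mul, abs_mul, abs_of_nonneg ha, abs_of_nonneg hc]
      have hsum : a * (|x 0| + |x 1| + |x 2|) + c * (|y 0| + |y 1| + |y 2|) < 4 * θ * μ := by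
        have e : a * (4 * θ * μ) + c * (4 * θ * μ) = 4 * θ * μ := by
          rw [← add_mul, hac, one_mul]
        rcases ha.lt_or_eq with ha' | ha'
        · have := mul_lt_mul_of_pos_left hx ha'
          have := mul_le_mul_of_nonneg_left hy.le hc
          linarith
        · subst ha'
          simp only [zero_add] at hac
          subst hac
          simpa using hy
      linarith [t0 0, t0 1, t0 2]
    exact hOc.linear_preimage (Matrix.toLin' T)
  -- volumes
  have hdetT : T.det = 12 * Real.sqrt 3 := by
    have hs3 : Real.sqrt 3 ^ 2 = 3 := Real.sq_sqrt (by norm_num)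
    simp only [T, Matrix.det_fin_three, Matrix.of_apply, Matrix.cons_val', Matrix.cons_val_zero,
      Matrix.cons_val_one, Matrix.cons_val_two, Matrix.empty_val', Matrix.cons_val_fin_one,
      Matrix.head_cons, Matrix.tail_cons, Matrix.head_fin_const]
    linear_combination (6 * Real.sqrt 3) * hθ
  have hs0 : 0 < Real.sqrt 3 := Real.sqrt_pos.mpr (by norm_num)
  have hdetT0 : LinearMap.det (Matrix.toLin' T) ≠ 0 := by
    rw [LinearMap.det_toLin', hdetT]; positivity
  have hvolO : volume O = ENNReal.ofReal ((4 * θ * μ) ^ 3 * (4 / 3)) := by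
    have h := MeasureTheory.volume_sum_rpow_lt (ι := Fin 3) (p := 1) le_rfl (4 * θ * μ)
    simp only [Fintype.card_fin] at h
    rw [show O = {x : Fin 3 → ℝ | (∑ i, |x i| ^ (1 : ℝ)) ^ (1 / (1 : ℝ)) < 4 * θ * μ} from rfl, h]
    have hG2 : Real.Gamma (1 / (1 : ℝ) + 1) = 1 := by
      rw [show (1 : ℝ) / 1 + 1 = (1 : ℕ) + 1 by norm_num, Real.Gamma_nat_eq_factorial]; norm_num
    have hG4 : Real.Gamma ((3 : ℕ) / (1 : ℝ) + 1) = 6 := by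
      rw [show ((3 : ℕ) : ℝ) / 1 + 1 = (3 : ℕ) + 1 by norm_num, Real.Gamma_nat_eq_factorial]
      norm_num [Nat.factorial]
    rw [hG2, hG4, ← ENNReal.ofReal_pow (by positivity), ← ENNReal.ofReal_mul (by positivity)]
    norm_num
  have hvolS : volume S = ENNReal.ofReal ((12 * Real.sqrt 3)⁻¹ * ((4 * θ * μ) ^ 3 * (4 / 3))) := by
    rw [show S = (Matrix.toLin' T) ⁻¹' O from rfl, Measure.addHaar_preimage_linearMap _ hdetT0,
      LinearMap.det_toLin', hdetT, hvolO, ← ENNReal.ofReal_mul (by positivity),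
      abs_of_pos (by positivity)]
  have hvolF : volume (ZSpan.fundamentalDomain b) = ENNReal.ofReal m := by
    rw [ZSpan.volume_fundamentalDomain, hb, hdet, Nat.abs_cast]
  have h_vol : volume (ZSpan.fundamentalDomain b) * 2 ^ finrank ℝ (Fin 3 → ℝ) < volume S := by
    rw [hvolF, hvolS, finrank_fin_fun, show (2 : ENNReal) ^ 3 = ENNReal.ofReal 8 by norm_num,
      ← ENNReal.ofReal_mul (by positivity), ENNReal.ofReal_lt_ofReal_iff (by positivity)]
    -- 8 m < (12√3)⁻¹ · 128 m · 4/3, i.e. 72√3 < 128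
    have hcube : (4 * θ * μ) ^ 3 = 128 * m := by
      rw [show (4 * θ * μ) ^ 3 = 64 * θ ^ 3 * μ ^ 3 by ring, hθ, hμ]; ring
    rw [hcube]
    have hs : Real.sqrt 3 < 16 / 9 := by
      rw [Real.sqrt_lt' (by norm_num)]; norm_num
    have hmpos : (0 : ℝ) < m := by exact_mod_cast hm
    rw [show (12 * Real.sqrt 3)⁻¹ * (128 * (m : ℝ) * (4 / 3)) = (128 * m * 4 / 3) / (12 * Real.sqrt 3)
      by ring, lt_div_iff₀ (by positivity)]
    nlinarith
  -- Minkowski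
  obtain ⟨⟨x, hx⟩, hx0, hxS⟩ :=
    exists_ne_zero_mem_lattice_of_measure_mul_two_pow_lt_measure h_fund h_symm h_conv h_vol
  rw [mem_toAddSubgroup, Submodule.mem_span_range_iff_exists_fun] at hx
  obtain ⟨k, hk⟩ := hx
  have hx0' : x 0 = (k 0 : ℝ) * m - k 1 * ν - k 2 * ν ^ 2 := by
    rw [← hk]; simp [hb, bv, Fin.sum_univ_three, zsmul_eq_mul]; ring
  have hx1 : x 1 = (k 1 : ℝ) := by
    rw [← hk]; simp [hb, bv, Fin.sum_univ_three, zsmul_eq_mul]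
  have hx2 : x 2 = (k 2 : ℝ) := by
    rw [← hk]; simp [hb, bv, Fin.sum_univ_three, zsmul_eq_mul]
  refine ⟨k 0 * m - k 1 * ν - k 2 * ν ^ 2, k 1, k 2, ?_, ⟨k 0, by ring⟩, ?_⟩
  · by_contra hzero
    simp only [not_or, ne_eq, not_not] at hzero
    obtain ⟨h0, h1, h2⟩ := hzero
    apply hx0
    have hk0 : k 0 = 0 := by
      rw [h1, h2] at h0
      have : k 0 * (m : ℤ) = 0 := by linarith
      rcases mul_eq_zero.mp this with h | h
      · exact h
      · exfalso; exact (show (m : ℤ) ≠ 0 by exact_mod_cast (show m ≠ 0 by omega)) h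
    have hxz : x = 0 := by
      rw [← hk, Fin.sum_univ_three, hk0, h1, h2]; simp
    exact Subtype.ext hxz
  · have hxS' : x ∈ S := hxS
    rw [hS] at hxS'
    have e3 : |Real.sqrt 3 * θ * x 1 - Real.sqrt 3 * θ ^ 2 * x 2|
        = Real.sqrt 3 * |θ * x 1 - θ ^ 2 * x 2| := by
      rw [show Real.sqrt 3 * θ * x 1 - Real.sqrt 3 * θ ^ 2 * x 2
          = Real.sqrt 3 * (θ * x 1 - θ ^ 2 * x 2) by ring, abs_mul, abs_of_pos hs0]
    rw [e3, hx0', hx1, hx2] at hxS'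
    push_cast
    exact hxS'

/-- **Small multiple of the norm.** For `m ≥ 1` and any integer `ν` there is a non-zero integer
triple `(p, q, r)` with `m ∣ p + qν + rν²` and `|p³ + 2q³ + 4r³ - 6pqr| < 5m` (Minkowski's
theorem for the body of `exists_ne_zero_mem_lattice` with `θ = 2^{1/3}`, `μ = m^{1/3}`, and the
bound `|N| ≤ ((|ℓ₁| + |ℓ₂| + √3|ℓ₃|)/3)³ < (4θμ/3)³ = 128m/27`). [folklore] -/
theorem exists_small_norm (m : ℕ) (hm : 1 ≤ m) (ν : ℤ) :
    ∃ p q r : ℤ, (p ≠ 0 ∨ q ≠ 0 ∨ r ≠ 0) ∧ (m : ℤ) ∣ p + q * ν + r * ν ^ 2 ∧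
      |p ^ 3 + 2 * q ^ 3 + 4 * r ^ 3 - 6 * p * q * r| < 5 * (m : ℤ) := by
  set θ : ℝ := (2 : ℝ) ^ ((1 : ℝ) / 3) with hθdef
  set μ : ℝ := (m : ℝ) ^ ((1 : ℝ) / 3) with hμdef
  have hθ : θ ^ 3 = 2 := by
    rw [hθdef, ← Real.rpow_natCast, ← Real.rpow_mul (by norm_num)]; norm_num
  have hθ0 : 0 < θ := Real.rpow_pos_of_pos (by norm_num) _
  have hmpos : (0 : ℝ) < m := by exact_mod_cast hm
  have hμ : μ ^ 3 = m := by
    rw [hμdef, ← Real.rpow_natCast, ← Real.rpow_mul hmpos.le]; norm_num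
  have hμ0 : 0 < μ := Real.rpow_pos_of_pos hmpos _
  obtain ⟨p, q, r, hne, hdvd, hbody⟩ := exists_ne_zero_mem_lattice hθ hθ0 m hm hμ hμ0 ν
  refine ⟨p, q, r, hne, hdvd, ?_⟩
  have hle := abs_normForm_le hθ (p : ℝ) q r
  have hnonneg : 0 ≤ |(p : ℝ) + θ * q + θ ^ 2 * r| + |2 * (p : ℝ) - θ * q - θ ^ 2 * r|
      + Real.sqrt 3 * |θ * q - θ ^ 2 * r| := by positivity
  have hlt : ((|(p : ℝ) + θ * q + θ ^ 2 * r| + |2 * (p : ℝ) - θ * q - θ ^ 2 * r|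
      + Real.sqrt 3 * |θ * q - θ ^ 2 * r|) / 3) ^ 3 < (4 * θ * μ / 3) ^ 3 := by
    gcongr
  have hcube : (4 * θ * μ / 3) ^ 3 = 128 * m / 27 := by
    rw [show (4 * θ * μ / 3) ^ 3 = 64 * θ ^ 3 * μ ^ 3 / 27 by ring, hθ, hμ]; ring
  have hreal : |((p ^ 3 + 2 * q ^ 3 + 4 * r ^ 3 - 6 * p * q * r : ℤ) : ℝ)| < 5 * m := by
    push_cast
    linarith
  have hcast : (((|p ^ 3 + 2 * q ^ 3 + 4 * r ^ 3 - 6 * p * q * r| : ℤ) : ℝ)) < ((5 * m : ℤ) : ℝ) := by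
    rw [Int.cast_abs]; push_cast; push_cast at hreal; exact hreal
  exact_mod_cast hcast

end Welsh2018

end Literature.NumberTheory.Sieve
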